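import Summits.CriticalPhenomena.CardyFormulaZ2.Theorems.CardySusyWardParafermionFamiliesToSLESixFluxPropagationLattice

/-!
# Flux propagation (stub S6, crux stmt-CriticalPhenomena-10814), III: Green's identity and the per-vertex bounds

Helper file 3/4 for `stub_fluxPropagationI`. At one scale `δ` (admissible data `E = Λ δ` of the Dobrushin
domain `D`, straight wall `LocalHalfPlane D w₀ n r`, box height `h`, grid of `N ≈ h/(8δ)` steps): the flux of
the half-CR corner form out of any finite set of INTERIOR medial vertices vanishes (barrier Green identity
`sum_halfCRForm_eq_halfCRFlux` + the half-CR vertex relation S2; registered one-line form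
`stub_flux_greenZero`); applied to `S′` it gives WALL FLUX = −(OPEN FLUX) (`wallFlux_eq_neg_open`: deep
vertices have interior twins). Then the per-vertex majorant `phi` of the open flux: envelope (S3) on the
transversals, nothing below the staircase, the exact side-pair decomposition + bridge (S1) + vertex and
staggered vanishing at regular staircase vertices, envelope at staircase corners. [folklore]
-/

noncomputable section

namespace Summit.CriticalPhenomena.CardyFormulaZ2.Theorems.ParafermionFamiliesToSLESix.StripAnchored

open MeasureTheory Filter Set Metric Complex
open scoped Topology BigOperators ComplexConjugate
open Literature.Probability.LatticeModels
open Literature.Probability.RandomPlanarGeometry (DobrushinDomain)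
open Literature.Barriers.CriticalPhenomena (medialCornersAt medialVertexOf isCorner_medialCornersAt halfCRFlux)
open Literature.Barriers.CriticalPhenomena.HalfCRGreen (coeff twin)
open Summit.CriticalPhenomena.CardyFormulaZ2.Cruxes.EdgePrecompact.QkzStripBoundaryArm (cornerObs)

namespace S6

/-! ## The objects of the open-flux estimate -/

open Classical in
/-- The OPEN FLUX functional at `p`: the flux corners of `p` into interior vertices outside `S`. [folklore] -/
def bflux (E : DiscreteDobrushin) (δ : ℝ) (S : Finset (Site 2 × Fin 2)) (p : Site 2 × Fin 2) : ℂ :=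
  ∑ k : Fin 4, (if IsInteriorMV E (twin p.1 p.2 k) ∧ twin p.1 p.2 k ∉ S then coeff I k * G E δ p k else 0)

/-- Depth LAYER index of `p` on the transversals: `⌊t/δ - 1/2⌋`. [folklore] -/
def jp (w₀ n : ℂ) (δ : ℝ) (p : Site 2 × Fin 2) : ℕ := ⌊τc w₀ n δ p / δ - 1 / 2⌋₊

/-- The envelope profile of layer `j`: `max(1, j)^{-1/3}`. [folklore] -/
def gj (j : ℕ) : ℝ := ((max 1 j : ℕ) : ℝ) ^ (-(1:ℝ) / 3)

/-- The number (`0, 1, 2`) of doubled coordinates of `p` adjacent to a grid line of doubled modulus `2N`. [folklore] -/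
def ncross (N : ℕ) (p : Site 2 × Fin 2) : ℕ :=
  (if U p % (2 * N) = 0 ∨ U p % (2 * N) = 2 * N - 1 then 1 else 0) + (if V p % (2 * N) = 0 ∨ V p % (2 * N) = 2 * N - 1 then 1 else 0)

/-- The per-vertex MAJORANT of the open flux: envelope on the lateral strips, `3εδ^{1/3}` at staircase vertices adjacent to a grid line, plus `4C` at staircase corners (adjacent to two grid lines). [folklore] -/
def phi (w₀ n : ℂ) (δ r h C ε : ℝ) (N : ℕ) (p : Site 2 × Fin 2) : ℝ :=
  (if r - δ ≤ |σc w₀ n δ p| then 4 * C * gj (jp w₀ n δ p) else 0) +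
  (if (|σc w₀ n δ p| < r - δ ∧ h < τc w₀ n δ p) ∧ 1 ≤ ncross N p then 3 * ε * δ ^ ((1:ℝ) / 3) else 0) +
  (if (|σc w₀ n δ p| < r - δ ∧ h < τc w₀ n δ p) ∧ ncross N p = 2 then 4 * C else 0)

/-- The profile is nonnegative. [folklore] -/
theorem gj_nonneg (j : ℕ) : 0 ≤ gj j := Real.rpow_nonneg (Nat.cast_nonneg _) _

/-- `ncross` read back. [folklore] -/
theorem ncross_cases (N : ℕ) (p : Site 2 × Fin 2) :
    ((U p % (2 * N) = 0 ∨ U p % (2 * N) = 2 * N - 1) ∧ (V p % (2 * N) = 0 ∨ V p % (2 * N) = 2 * N - 1) ↔ ncross N p = 2) ∧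
    ((U p % (2 * N) = 0 ∨ U p % (2 * N) = 2 * N - 1) ∨ (V p % (2 * N) = 0 ∨ V p % (2 * N) = 2 * N - 1) ↔ 1 ≤ ncross N p) := by
  unfold ncross
  constructor <;> split_ifs <;> simp_all

/-- Each open-flux summand is bounded by the corner observable. [folklore] -/
theorem norm_bflux_le_sum {E : DiscreteDobrushin} {δ : ℝ} (S : Finset (Site 2 × Fin 2)) (p : Site 2 × Fin 2) :
    ‖bflux E δ S p‖ ≤ ∑ k : Fin 4, ‖G E δ p k‖ := by
  classical
  refine (norm_sum_le _ _).trans (Finset.sum_le_sum fun k _ => ?_)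
  split_ifs
  · rw [norm_mul, norm_coeff_I, one_mul]
  · rw [norm_zero]; exact norm_nonneg _

/-- A sum of four equal terms. [folklore] -/
theorem sum_fin_four_const (c : ℝ) : ∑ _k : Fin 4, c = 4 * c := by
  rw [Finset.sum_const, Finset.card_univ, Fintype.card_fin, nsmul_eq_mul]; push_cast; ring

/-- **The corner field is divergence-free on interior vertices**: the half-CR flux of `cornerObs` out of any finite set of interior medial vertices of admissible data discretising a Dobrushin domain vanishes (Green + S2). [folklore] -/
theorem halfCRFlux_eq_zero_of_interior (D : DobrushinDomain) {E : DiscreteDobrushin} (hEΩ : E.Ω = D.carrier)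
    (hE : E.IsZdAdmissible) {δ : ℝ} (hδ : 0 < δ) {S : Finset (Site 2 × Fin 2)} (hS : ∀ p ∈ S, IsInteriorMV E p) :
    halfCRFlux I S (fun c : Site 2 × Site 2 => cornerObs E δ c.1 c.2) = 0 := by
  rw [← Literature.Barriers.CriticalPhenomena.sum_halfCRForm_eq_halfCRFlux]
  exact Finset.sum_eq_zero fun p hp => (Literature.Barriers.CriticalPhenomena.halfCRRelationAt_iff _ _ _).1
    (halfCRVertexRelation_of_dobrushinDomain D E hEΩ hE p (hS p hp) δ hδ)

section Estimates

variable {D : DobrushinDomain} {E : DiscreteDobrushin} {w₀ n : ℂ} {r h δ C ε : ℝ} {N : ℕ}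
  (hw : LocalHalfPlane D w₀ n r) (hEΩ : E.Ω = D.carrier) (hEδ : E.δ = δ) (hE : E.IsZdAdmissible)
  (hh : 0 < h) (hhr : h ≤ r / 4) (hδh : δ ≤ h / 16) (hC : 1 ≤ C) (hε : 0 ≤ ε)
  (hN1 : h / (8 * δ) ≤ N) (hN2 : (N : ℝ) ≤ h / (8 * δ) + 1)
  (hmesh : ∀ x : Site 2, meshPoint δ x ∈ collar w₀ n (2 * r) (h / 4) (3 * h) → x ∈ meshDomain D.carrier δ)
  (hUIE : ∀ (v f : Site 2), IsCorner v f → ∀ R : ℕ, 1 ≤ R →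
    (R : ℝ) * δ ≤ infDist (meshPoint δ v) D.carrierᶜ → ‖cornerObs E δ v f‖ ≤ C * (R : ℝ) ^ (-(1:ℝ) / 3))
  (hVan : ∀ p : Site 2 × Fin 2, medialPoint δ (medialVertexOf p) ∈ collar w₀ n (2 * r) (h / 4) (3 * h) →
    ‖vertexObs E δ (medialVertexOf p)‖ ≤ ε * δ ^ ((1:ℝ) / 3))
  (hSt : ∀ p : Site 2 × Fin 2, medialPoint δ (medialVertexOf p) ∈ collar w₀ n (2 * r) (h / 4) (3 * h) →
    ‖stagger E δ p‖ ≤ ε * δ ^ ((1:ℝ) / 3))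

include hEδ hE hh hhr hδh hN1 hN2 in
/-- The scale parameters: `0 < δ ≤ r/16`, `N ≥ 2`, `h/8 ≤ Nδ ≤ h/4`. [folklore] -/
theorem basics : 0 < δ ∧ δ ≤ r / 16 ∧ 2 ≤ N ∧ h / 8 ≤ N * δ ∧ (N : ℝ) * δ ≤ h / 4 := by
  have hδ : 0 < δ := hEδ ▸ hE.delta_pos
  have hN0r : (2:ℝ) ≤ N := le_trans (by rw [le_div_iff₀ (by positivity)]; linarith) hN1
  refine ⟨hδ, by linarith, by exact_mod_cast hN0r, by rw [div_le_iff₀ (by positivity)] at hN1; linarith, ?_⟩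
  have : (N : ℝ) * δ ≤ (h / (8 * δ) + 1) * δ := mul_le_mul_of_nonneg_right hN2 hδ.le
  rw [show (h / (8 * δ) + 1) * δ = h / 8 + δ by field_simp] at this
  linarith

include hw hEΩ hEδ in
/-- Interior medial vertices near the wall point have positive normal coordinate (both endpoints of the lattice edge are sites of `Ω_δ`, hence in the half-plane). [folklore] -/
theorem τc_pos_of_interior (hδ : 0 ≤ δ) (hδr : δ ≤ r) {p : Site 2 × Fin 2} (hp : IsInteriorMV E p)
    (hnear : ‖medialPoint δ (medialVertexOf p) - w₀‖ < 2 * r) : 0 < τc w₀ n δ p := by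
  have key : ∀ v : Site 2, v ∈ meshDomain E.Ω E.δ → (v = p.1 ∨ v = p.1 + Pi.single p.2 1) → 0 < nco w₀ n (meshPoint δ v) := by
    intro v hv hv'
    have hvD : meshPoint δ v ∈ D.carrier := by rw [← hEΩ, ← hEδ]; exact meshDomain_subset_meshVertices _ _ hv
    have hd := norm_endpoint_sub_medialPoint hδ p.1 p.2 hv'
    refine (mem_carrier_iff hw ?_).1 hvD
    linarith [norm_sub_le_norm_sub_add_norm_sub (meshPoint δ v) (medialPoint δ (medialVertexOf p)) w₀]
  have h1 := key _ (mem_meshDomain_of_interior hp).1 (Or.inl rfl)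
  have h2 := key _ (mem_meshDomain_of_interior hp).2 (Or.inr rfl)
  have hmid : τc w₀ n δ p = (nco w₀ n (meshPoint δ p.1) + nco w₀ n (meshPoint δ (p.1 + Pi.single p.2 1))) / 2 := by
    simp only [τc, nco]
    rw [show medialPoint δ (medialVertexOf p) = (meshPoint δ p.1 + meshPoint δ (p.1 + Pi.single p.2 1)) / 2 from rfl,
      show ((meshPoint δ p.1 + meshPoint δ (p.1 + Pi.single p.2 1)) / 2 - w₀) * conj n =
        ((meshPoint δ p.1 - w₀) * conj n + (meshPoint δ (p.1 + Pi.single p.2 1) - w₀) * conj n) / 2 by ring]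
    simp
  rw [hmid]; linarith

include hw hEΩ hEδ hE hh hhr hδh hN1 hN2 hmesh in
/-- **Deep vertices have interior twins**: with the lattice points of the collar `{|s| ≤ 2r, h/4 ≤ t ≤ 3h}` in `Ω_δ`, a medial vertex with `|s| < r`, `h - δ ≤ t < 2h` has its four twins interior. [folklore] -/
theorem twin_interior {p : Site 2 × Fin 2} (hs : |σc w₀ n δ p| < r) (ht1 : h - δ ≤ τc w₀ n δ p) (ht2 : τc w₀ n δ p < 2 * h)
    (k : Fin 4) : IsInteriorMV E (twin p.1 p.2 k) := by
  obtain ⟨hδ, -, -⟩ := basics hEδ hE hh hhr hδh hN1 hN2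
  have hn := hw.1
  have hKΩ : collar w₀ n (2 * r) (h / 4) (3 * h) ⊆ E.Ω := by rw [hEΩ]; exact collar_subset hw (by linarith) (by linarith)
  change IsInteriorMV E ((twin p.1 p.2 k).1, (twin p.1 p.2 k).2)
  refine interior_of_nbhd (convex_collar _ _ _ _ _) hKΩ _ _ fun u hu => ?_
  -- `u` is within sup-distance 3 of `p.1`, hence within `7δ` of the medial point
  have hu3 : ∀ l, |u l - p.1 l| ≤ 3 := fun l => by
    have h1 := hu l; have h2 := abs_twin_sub_le p.1 p.2 k l
    rw [abs_le] at h1 h2 ⊢; constructor <;> linarith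
  have hdist : ‖meshPoint δ u - medialPoint δ (medialVertexOf p)‖ ≤ 7 * δ := by
    have h1 := norm_meshPoint_sub_le hδ.le u p.1
    have h2 := norm_meshPoint_fst_sub_medialPoint hδ.le p
    have h3 : |((u 0 - p.1 0 : ℤ) : ℝ)| ≤ 3 := by exact_mod_cast hu3 0
    have h4 : |((u 1 - p.1 1 : ℤ) : ℝ)| ≤ 3 := by exact_mod_cast hu3 1
    have := norm_sub_le_norm_sub_add_norm_sub (meshPoint δ u) (meshPoint δ p.1) (medialPoint δ (medialVertexOf p))
    nlinarith
  have hτ := abs_nco_sub_le hn w₀ (meshPoint δ u) (medialPoint δ (medialVertexOf p))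
  have hσ := abs_tco_sub_le hn w₀ (meshPoint δ u) (medialPoint δ (medialVertexOf p))
  rw [abs_le] at hτ hσ
  have hs' : |tco w₀ n (medialPoint δ (medialVertexOf p))| < r := hs
  have ht1' : h - δ ≤ nco w₀ n (medialPoint δ (medialVertexOf p)) := ht1
  have ht2' : nco w₀ n (medialPoint δ (medialVertexOf p)) < 2 * h := ht2
  rw [abs_lt] at hs'
  have hmem : meshPoint δ u ∈ collar w₀ n (2 * r) (h / 4) (3 * h) :=
    ⟨abs_le.2 ⟨by linarith, by linarith⟩, by linarith, by linarith⟩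
  exact ⟨by rw [hEΩ, hEδ]; exact hmesh u hmem, by rw [hEδ]; exact hmem⟩

include hw hEδ hE hh hhr hδh hN1 hN2 in
/-- Vertices of `S′` have normal coordinate `< 2h` and are within `3r/2` of the wall point. [folklore] -/
theorem lt_of_mem {p : Site 2 × Fin 2} (hp : p ∈ Sset E w₀ n δ r h N) :
    τc w₀ n δ p < 2 * h ∧ ‖medialPoint δ (medialVertexOf p) - w₀‖ < 3 * r / 2 := by
  obtain ⟨hδ, -, hN2', -, hL⟩ := basics hEδ hE hh hhr hδh hN1 hN2
  have hp' := (mem_Sset hE).1 hp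
  have h2 := abs_τc_sub_cellDepth_le (w₀ := w₀) hw.1 hδ (by omega : 0 < N) p
  rw [abs_le] at h2
  have ht : τc w₀ n δ p < 2 * h := by linarith [hp'.2.2.2]
  exact ⟨ht, norm_medialPoint_sub_lt hw.1 hhr hp'.2.1 hp'.2.2.1 ht⟩

include hw hEδ hE hh hhr hδh hN1 hN2 in
/-- Vertices in HIGH cells have normal coordinate `≥ 5h/4`. [folklore] -/
theorem le_τc_of_not_low {p : Site 2 × Fin 2} (hp : ¬ cellDepth w₀ n δ N p < 3 * h / 2) : 5 * h / 4 ≤ τc w₀ n δ p := by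
  obtain ⟨hδ, -, hN2', -, hL⟩ := basics hEδ hE hh hhr hδh hN1 hN2
  have h2 := abs_τc_sub_cellDepth_le (w₀ := w₀) hw.1 hδ (by omega : 0 < N) p
  rw [abs_le] at h2; push Not at hp; linarith

/-! ## The Green identity on `S′`: wall flux = −(open flux) -/

include hw hEΩ hEδ hE hh hhr hδh hN1 hN2 hmesh in
open Classical in
/-- **Wall flux = −(open flux).** The wall flux through the box is the part of the flux out of `S′` into NON-interior vertices (the box part of `S′` is exactly the support of `wallFlux`, and deep vertices of `S′` have interior twins); by `halfCRFlux_eq_zero_of_interior` it is minus the open flux. [folklore] -/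
theorem wallFlux_eq_neg_open :
    wallFlux I E δ (wallBox w₀ n r h) = -∑ p ∈ Sset E w₀ n δ r h N, bflux E δ (Sset E w₀ n δ r h N) p := by
  classical
  obtain ⟨hδ, -, hN2', -, hL⟩ := basics hEδ hE hh hhr hδh hN1 hN2
  have hn := hw.1
  have hr := hw.2.1
  set S := Sset E w₀ n δ r h N with hSdef
  have hS : ∀ p, p ∈ S ↔ _ := fun p => mem_Sset (w₀ := w₀) (n := n) (δ := δ) (r := r) (h := h) (N := N) hE (p := p)
  have hcell : ∀ p, |τc w₀ n δ p - cellDepth w₀ n δ N p| ≤ N * δ := fun p =>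
    abs_τc_sub_cellDepth_le hn hδ (by omega) p
  -- the box part of `S` is exactly the support of the wall flux
  have hbox : ∀ p, (IsInteriorMV E p ∧ medialPoint δ (medialVertexOf p) ∈ wallBox w₀ n r h) ↔ (p ∈ S ∧ τc w₀ n δ p < h) := by
    intro p
    rw [hS, mem_wallBox_iff]
    constructor
    · rintro ⟨hp, hs, ht⟩
      have hnear : ‖medialPoint δ (medialVertexOf p) - w₀‖ < 2 * r := by
        have := norm_sub_le_nco_tco hn w₀ (medialPoint δ (medialVertexOf p)); linarith
      have ht' : τc w₀ n δ p < h := (abs_lt.1 ht).2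
      have := hcell p
      rw [abs_le] at this
      exact ⟨⟨hp, hs, τc_pos_of_interior hw hEΩ hEδ hδ.le (by linarith) hp hnear, by linarith⟩, ht'⟩
    · rintro ⟨⟨hp, hs, hpos, -⟩, ht⟩
      exact ⟨hp, hs, abs_lt.2 ⟨by linarith [show 0 < nco w₀ n (medialPoint δ (medialVertexOf p)) from hpos], ht⟩⟩
  -- wall part: finsum → finite sum over `S`, deep vertices contribute nothing
  have hwall : wallFlux I E δ (wallBox w₀ n r h) =
      ∑ p ∈ S, ∑ k : Fin 4, (if IsInteriorMV E (twin p.1 p.2 k) then (0:ℂ) else coeff I k * G E δ p k) := by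
    unfold wallFlux
    rw [finsum_eq_sum_of_support_subset (s := S)]
    · refine Finset.sum_congr rfl fun p hp => ?_
      split_ifs with hc
      · rfl
      · have ht : h ≤ τc w₀ n δ p := by by_contra hlt; exact hc ((hbox p).2 ⟨hp, not_le.1 hlt⟩)
        refine (Finset.sum_eq_zero fun k _ => ?_).symm
        rw [if_pos (twin_interior hw hEΩ hEδ hE hh hhr hδh hN1 hN2 hmesh ((hS p).1 hp).2.1 (by linarith)
          (lt_of_mem hw hEδ hE hh hhr hδh hN1 hN2 hp).1 k)]
    · intro p hp
      rw [Function.mem_support] at hp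
      by_cases hc : IsInteriorMV E p ∧ medialPoint δ (medialVertexOf p) ∈ wallBox w₀ n r h
      · exact Finset.mem_coe.2 ((hbox p).1 hc).1
      · exact absurd (if_neg hc) hp
  -- Green: wall part + open part = total flux = 0
  have hgreen := halfCRFlux_eq_zero_of_interior D hEΩ hE hδ (S := S) fun p hp => ((hS p).1 hp).1
  unfold halfCRFlux at hgreen
  rw [hwall, eq_neg_iff_add_eq_zero, ← Finset.sum_add_distrib]
  refine Eq.trans (Finset.sum_congr rfl fun p _ => ?_) hgreen
  rw [bflux, ← Finset.sum_add_distrib]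
  refine Finset.sum_congr rfl fun k _ => ?_
  by_cases h1 : twin p.1 p.2 k ∈ S
  · rw [if_pos h1, if_pos ((hS _).1 h1).1, if_neg (fun h => h.2 h1), add_zero]
  · by_cases h2 : IsInteriorMV E (twin p.1 p.2 k)
    · rw [if_neg h1, if_pos h2, if_pos ⟨h2, h1⟩, zero_add]; rfl
    · rw [if_neg h1, if_neg h2, if_neg (fun h => h2 h.1), add_zero]; rfl

/-! ## The per-vertex bounds of the open flux -/

include hw hEΩ hEδ hE hh hhr hδh hN1 hN2 hUIE in
/-- **Envelope on `S′`**: `‖G E δ p k‖ ≤ C · max(1, j_p)^{-1/3} ≤ C` (the corner site has depth `> δ` and `≥ t_p - δ/2`). [folklore] -/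
theorem norm_G_le_gj {p : Site 2 × Fin 2} (hp : p ∈ Sset E w₀ n δ r h N) (k : Fin 4) :
    ‖G E δ p k‖ ≤ C * gj (jp w₀ n δ p) ∧ ‖G E δ p k‖ ≤ C := by
  obtain ⟨hδ, hδr, -, -, -⟩ := basics hEδ hE hh hhr hδh hN1 hN2
  have hn := hw.1
  have hr := hw.2.1
  have hnear := (lt_of_mem hw hEδ hE hh hhr hδh hN1 hN2 hp).2
  have h2 := norm_corner_sub_medialPoint hδ.le p k
  -- depth of the corner site
  have hd : δ < nco w₀ n (meshPoint δ (medialCornersAt p.1 p.2 k).1) := by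
    have h := delta_lt_nco_corner hw hEΩ hE ((mem_Sset hE).1 hp).1 k ?_
    · rwa [hEδ] at h
    · intro u hu
      rw [hEδ]
      have h1 := norm_meshPoint_sub_le hδ.le u (medialCornersAt p.1 p.2 k).1
      have h3 : |((u 0 - (medialCornersAt p.1 p.2 k).1 0 : ℤ) : ℝ)| ≤ 1 := by exact_mod_cast hu 0
      have h4 : |((u 1 - (medialCornersAt p.1 p.2 k).1 1 : ℤ) : ℝ)| ≤ 1 := by exact_mod_cast hu 1
      have h5 := norm_sub_le_norm_sub_add_norm_sub (meshPoint δ u) (meshPoint δ (medialCornersAt p.1 p.2 k).1)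
        (medialPoint δ (medialVertexOf p))
      have h6 := norm_sub_le_norm_sub_add_norm_sub (meshPoint δ u) (medialPoint δ (medialVertexOf p)) w₀
      nlinarith
  -- the envelope, at lattice depth `R`
  have henv : ∀ R : ℕ, 1 ≤ R → (R : ℝ) * δ ≤ nco w₀ n (meshPoint δ (medialCornersAt p.1 p.2 k).1) →
      ‖G E δ p k‖ ≤ C * (R : ℝ) ^ (-(1:ℝ) / 3) := fun R hR hRδ =>
    hUIE _ _ (isCorner_medialCornersAt p.1 p.2 k) R hR (hRδ.trans (nco_le_infDist hw (by
      linarith [norm_sub_le_norm_sub_add_norm_sub (meshPoint δ (medialCornersAt p.1 p.2 k).1)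
        (medialPoint δ (medialVertexOf p)) w₀])))
  have hC1 : ‖G E δ p k‖ ≤ C := by simpa using henv 1 le_rfl (by simpa using hd.le)
  refine ⟨?_, hC1⟩
  rcases Nat.eq_zero_or_pos (jp w₀ n δ p) with h0 | hpos
  · rw [gj, h0]; simpa using hC1
  · refine henv _ (le_max_left _ _) ?_
    rw [max_eq_right hpos]
    simp only [jp] at hpos ⊢
    have h1 : (1:ℝ) ≤ τc w₀ n δ p / δ - 1 / 2 := Nat.floor_pos.1 hpos
    have h3 := mul_le_mul_of_nonneg_right (Nat.floor_le (by linarith : (0:ℝ) ≤ τc w₀ n δ p / δ - 1 / 2)) hδ.le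
    rw [sub_mul, div_mul_cancel₀ _ hδ.ne'] at h3
    have h4 := abs_nco_sub_le hn w₀ (meshPoint δ (medialCornersAt p.1 p.2 k).1) (medialPoint δ (medialVertexOf p))
    rw [abs_le] at h4
    have hτ : τc w₀ n δ p = nco w₀ n (medialPoint δ (medialVertexOf p)) := rfl
    linarith

include hw hEΩ hEδ hE hh hhr hδh hN1 hN2 hUIE in
/-- **Lateral strips and staircase corners**: `‖bflux p‖ ≤ 4C·max(1,j_p)^{-1/3} ≤ 4C`. [folklore] -/
theorem norm_bflux_le {p : Site 2 × Fin 2} (hp : p ∈ Sset E w₀ n δ r h N) :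
    ‖bflux E δ (Sset E w₀ n δ r h N) p‖ ≤ 4 * C * gj (jp w₀ n δ p) ∧ ‖bflux E δ (Sset E w₀ n δ r h N) p‖ ≤ 4 * C := by
  have h := fun k => norm_G_le_gj hw hEΩ hEδ hE hh hhr hδh hN1 hN2 hUIE hp k
  constructor <;> refine (norm_bflux_le_sum _ p).trans ?_
  · refine (Finset.sum_le_sum fun k _ => (h k).1).trans ?_; rw [sum_fin_four_const]; linarith
  · refine (Finset.sum_le_sum fun k _ => (h k).2).trans ?_; rw [sum_fin_four_const]

include hw hEΩ hEδ hE hh hhr hδh hN1 hN2 in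
/-- An interior twin of a vertex of `S′` with `|s| < r - δ` is in `S′` as soon as its cell is low. [folklore] -/
theorem twin_mem_Sset {p : Site 2 × Fin 2} (hp : p ∈ Sset E w₀ n δ r h N) (hs : |σc w₀ n δ p| < r - δ) (k : Fin 4)
    (hq : IsInteriorMV E (twin p.1 p.2 k)) (hc : cellDepth w₀ n δ N (twin p.1 p.2 k) < 3 * h / 2) :
    twin p.1 p.2 k ∈ Sset E w₀ n δ r h N := by
  obtain ⟨hδ, -, -, -, -⟩ := basics hEδ hE hh hhr hδh hN1 hN2
  obtain ⟨hτq, hσq⟩ := abs_twin_coords_sub_le (w₀ := w₀) hw.1 hδ.le p k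
  rw [abs_le] at hσq hτq
  have hnq : ‖medialPoint δ (medialVertexOf (twin p.1 p.2 k)) - w₀‖ < 2 * r := by
    have := norm_sub_le_norm_sub_add_norm_sub (medialPoint δ (medialVertexOf (twin p.1 p.2 k)))
      (medialPoint δ (medialVertexOf p)) w₀
    linarith [norm_twin_sub_le hδ.le p k, hw.2.1, (lt_of_mem hw hEδ hE hh hhr hδh hN1 hN2 hp).2]
  refine (mem_Sset hE).2 ⟨hq, ?_, τc_pos_of_interior hw hEΩ hEδ hδ.le (by linarith [hw.2.1]) hq hnq, hc⟩
  rw [abs_lt] at hs ⊢; constructor <;> linarith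

include hw hEΩ hEδ hE hh hhr hδh hN1 hN2 in
/-- **Below the staircase, away from the transversals, nothing is open.** [folklore] -/
theorem bflux_eq_zero_of_mid {p : Site 2 × Fin 2} (hp : p ∈ Sset E w₀ n δ r h N) (hs : |σc w₀ n δ p| < r - δ)
    (ht : τc w₀ n δ p ≤ h) : bflux E δ (Sset E w₀ n δ r h N) p = 0 := by
  classical
  obtain ⟨hδ, -, -, -, -⟩ := basics hEδ hE hh hhr hδh hN1 hN2
  refine Finset.sum_eq_zero fun k _ => if_neg fun ⟨hq, hqS⟩ => hqS (twin_mem_Sset hw hEΩ hEδ hE hh hhr hδh hN1 hN2 hp hs k hq ?_)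
  by_contra hc
  have h1 := le_τc_of_not_low hw hEδ hE hh hhr hδh hN1 hN2 hc
  have h2 := (abs_twin_coords_sub_le (w₀ := w₀) hw.1 hδ.le p k).1
  rw [abs_le] at h2
  linarith

include hw hEΩ hEδ hE hh hhr hδh hN1 hN2 hmesh in
/-- **On the staircase region the open corners are exactly those into HIGH cells**, read through the doubled coordinates of the twins. [folklore] -/
theorem bflux_eq_of_top {p : Site 2 × Fin 2} (hp : p ∈ Sset E w₀ n δ r h N) (hs : |σc w₀ n δ p| < r - δ) (ht : h < τc w₀ n δ p)
    {K : Finset (Fin 4)} (hK : ∀ k, ¬ nco w₀ n (center (N * δ) (shU (U p) k / (2 * N)) (shV (V p) k / (2 * N))) < 3 * h / 2 ↔ k ∈ K) :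
    bflux E δ (Sset E w₀ n δ r h N) p = ∑ k ∈ K, coeff I k * G E δ p k := by
  classical
  obtain ⟨hδ, -, -, -, -⟩ := basics hEδ hE hh hhr hδh hN1 hN2
  have htw : ∀ k, IsInteriorMV E (twin p.1 p.2 k) := twin_interior hw hEΩ hEδ hE hh hhr hδh hN1 hN2 hmesh
    (by linarith [((mem_Sset hE).1 hp).2.1]) (by linarith) (lt_of_mem hw hEδ hE hh hhr hδh hN1 hN2 hp).1
  have hcd : ∀ k, cellDepth w₀ n δ N (twin p.1 p.2 k) = nco w₀ n (center (N * δ) (shU (U p) k / (2 * N)) (shV (V p) k / (2 * N))) :=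
    fun k => by simp only [cellDepth, U_twin', V_twin']
  rw [bflux, ← Finset.sum_filter]
  refine Finset.sum_congr ?_ fun k _ => rfl
  ext k
  rw [Finset.mem_filter, ← hK k, ← hcd]
  simp only [Finset.mem_univ, true_and]
  constructor
  · rintro ⟨-, hq⟩ hc; exact hq (twin_mem_Sset hw hEΩ hEδ hE hh hhr hδh hN1 hN2 hp hs k (htw k) hc)
  · intro hc; exact ⟨htw k, fun hq => hc ((mem_Sset hE).1 hq).2.2.2⟩

include hw hEΩ hEδ hE hh hhr hδh hC hε hN1 hN2 hmesh hUIE hVan hSt in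
/-- **The per-vertex bound `‖bflux p‖ ≤ φ p` on `S′`.** Lateral strips: envelope. Below the staircase: zero. Staircase corners (two adjacent grid lines): envelope at depth one. Regular staircase vertices: the outgoing corners form a side pair (`fiveWay_of_regular`), whose functional is `a·Σ_k G + ½·(half-CR form) + c·(staggered)` (`norm_partialFlux_le`); the half-CR form vanishes (S2), `Σ_k G = 2cos(π/12)·vertexObs` (S1) is `≤ 2εδ^{1/3}` and the staggered combination is `≤ εδ^{1/3}` on the collar. [folklore] -/
theorem norm_bflux_le_phi {p : Site 2 × Fin 2} (hp : p ∈ Sset E w₀ n δ r h N) :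
    ‖bflux E δ (Sset E w₀ n δ r h N) p‖ ≤ phi w₀ n δ r h C ε N p := by
  obtain ⟨hδ, -, hN2', -, -⟩ := basics hEδ hE hh hhr hδh hN1 hN2
  obtain ⟨hpI, hps, hpt, hpc⟩ := (mem_Sset hE).1 hp
  have he3 : 0 < δ ^ ((1:ℝ) / 3) := Real.rpow_pos_of_pos hδ _
  have hg := gj_nonneg (jp w₀ n δ p)
  have h4C : (0:ℝ) ≤ 4 * C := by linarith
  have h3ε : (0:ℝ) ≤ 3 * ε * δ ^ ((1:ℝ) / 3) := by positivity
  obtain ⟨hblat, hb4C⟩ := norm_bflux_le hw hEΩ hEδ hE hh hhr hδh hN1 hN2 hUIE hp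
  obtain ⟨hc2, hc1⟩ := ncross_cases N p
  unfold phi
  by_cases hl : r - δ ≤ |σc w₀ n δ p|
  · rw [if_pos hl]; split_ifs <;> linarith
  rw [if_neg hl]
  have hs : |σc w₀ n δ p| < r - δ := not_le.1 hl
  by_cases ht : h < τc w₀ n δ p
  swap
  · rw [bflux_eq_zero_of_mid hw hEΩ hEδ hE hh hhr hδh hN1 hN2 hp hs (not_lt.1 ht), norm_zero]; split_ifs <;> linarith
  by_cases hirr : (U p % (2 * N) = 0 ∨ U p % (2 * N) = 2 * N - 1) ∧ (V p % (2 * N) = 0 ∨ V p % (2 * N) = 2 * N - 1)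
  · rw [if_pos ⟨⟨hs, ht⟩, hc1.1 (Or.inl hirr.1)⟩, if_pos ⟨⟨hs, ht⟩, hc2.1 hirr⟩]; linarith
  obtain ⟨⟨K, hK, hPK⟩, hnone⟩ := fiveWay_of_regular (m := 2 * N) (by omega)
    (fun a b => nco w₀ n (center (N * δ) a b) < 3 * h / 2) hpc hirr
  rw [bflux_eq_of_top hw hEΩ hEδ hE hh hhr hδh hN1 hN2 hmesh hp hs ht hPK]
  by_cases hcr : (U p % (2 * N) = 0 ∨ U p % (2 * N) = 2 * N - 1) ∨ (V p % (2 * N) = 0 ∨ V p % (2 * N) = 2 * N - 1)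
  swap
  · obtain ⟨hcU, hcV⟩ := not_or.1 hcr
    have : K = ∅ := Finset.eq_empty_of_forall_notMem fun k hk => (hPK k).2 hk (hnone hcU hcV k)
    rw [this, Finset.sum_empty, norm_zero]; split_ifs <;> linarith
  rw [if_pos ⟨⟨hs, ht⟩, hc1.1 hcr⟩, if_neg (fun h' => hirr (hc2.2 h'.2))]
  -- the regular staircase vertex
  have hb := norm_partialFlux_le (fun k => G E δ p k) (halfCRVertexRelation_of_dobrushinDomain D E hEΩ hE p hpI δ hδ) hK
  have hcol : medialPoint δ (medialVertexOf p) ∈ collar w₀ n (2 * r) (h / 4) (3 * h) :=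
    ⟨by linarith [hw.2.1, show |tco w₀ n (medialPoint δ (medialVertexOf p))| < r from hps],
      by linarith [show h < nco w₀ n (medialPoint δ (medialVertexOf p)) from ht],
      by linarith [show nco w₀ n (medialPoint δ (medialVertexOf p)) < 2 * h from (lt_of_mem hw hEδ hE hh hhr hδh hN1 hN2 hp).1]⟩
  have hAB : medialVertexOf p ∉ E.zdABEdges := fun ⟨_, ⟨x, hx, hxA⟩, _⟩ => (hpI.2.1 x hx).1 hxA
  have hsum : ‖∑ k : Fin 4, G E δ p k‖ ≤ 2 * (ε * δ ^ ((1:ℝ) / 3)) := by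
    rw [show ∑ k : Fin 4, G E δ p k = ((2 * Real.cos (Real.pi / 12) : ℝ) : ℂ) * vertexObs E δ (medialVertexOf p) from
      (stub_vertexCornerBridge_unfolded E hE p hAB δ hδ).symm, norm_mul, Complex.norm_real]
    have hc : |2 * Real.cos (Real.pi / 12)| ≤ 2 := by
      rw [abs_mul, abs_two]; nlinarith [Real.abs_cos_le_one (Real.pi / 12), abs_nonneg (Real.cos (Real.pi / 12))]
    exact mul_le_mul hc (hVan p hcol) (norm_nonneg _) (by norm_num)
  have hst : ‖G E δ p 0 - G E δ p 1 + G E δ p 2 - G E δ p 3‖ ≤ ε * δ ^ ((1:ℝ) / 3) := hSt p hcol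
  exact hb.trans (by linarith)

end Estimates

end S6

open Literature.Probability.LatticeModels in
/-- **Registered one-line form `stub_flux_greenZero`** (sub-goal of stmt-CriticalPhenomena-10814 carried by this helper file): for admissible data discretising a Dobrushin domain, the half-CR flux (barrier file `halfCRFlux`, coefficient `i`) of the spin-`1/3` corner observable out of ANY finite set of interior medial vertices vanishes — the corner field is a divergence-free discrete form on the interior (Green's identity + Duminil-Copin's vertex relation S2). [folklore] -/
theorem stub_flux_greenZero : ∀ (D : DobrushinDomain) (E : DiscreteDobrushin) (δ : ℝ) (S : Finset (Site 2 × Fin 2)), E.Ω = D.carrier → E.IsZdAdmissible → 0 < δ → (∀ p ∈ S, IsInteriorMV E p) → Literature.Barriers.CriticalPhenomena.halfCRFlux Complex.I S (fun c : Site 2 × Site 2 => Summit.CriticalPhenomena.CardyFormulaZ2.Cruxes.EdgePrecompact.QkzStripBoundaryArm.cornerObs E δ c.1 c.2) = 0 :=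
  fun D _ _ _ hEΩ hE hδ hS => S6.halfCRFlux_eq_zero_of_interior D hEΩ hE hδ hS

end Summit.CriticalPhenomena.CardyFormulaZ2.Theorems.ParafermionFamiliesToSLESix.StripAnchored

end
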